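import Literature.NumberTheory.Transcendental.NesterenkoElimIdealPrime
import Literature.NumberTheory.Transcendental.NesterenkoEliminationZeros
import Literature.NumberTheory.Automorphic.ProjectiveElimination
import HarnessLib

/-!
# The zeros of the ideal `Ī(r)` over an ARBITRARY base field (LNM 1752 Ch. 3 §4, Def. 4.3) — proofs only

`Literature/NumberTheory/Transcendental/NesterenkoEliminationZerosGeneric.lean`. The tree proves
the Hauptsatz on Nesterenko's inertia forms `Ī(r)` (Nesterenko–Philippon (eds.), LNM 1752, Ch. 3
§4, Def. 4.3) for ideals of `ℚ[x₀, …, x_m]` — with complex zeros (`NesterenkoEliminationZeros.lean`)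
and with zeros in any algebraically closed field containing `ℚ` (`NesterenkoEliminationZerosK.lean`).
Chapter 10 of the book runs the theory of Ch. 3 §4 over the base field `K = ℂ(z)` (p. 153), so the
generic-field port of Proposition 4.4 (`NesterenkoElimIdealPrime.lean`, `NesterenkoChowFormPrime.lean`,
`NesterenkoEliminationK.lean`, …) needs the same statement for ideals of `F[x₀, …, x_m]`, `F` ANY
field, with zeros in an algebraically closed extension `L ⊇ F`. This file proves it, for the
generic objects `NesterenkoK.extIdeal`, `NesterenkoK.elimIdeal`, `NesterenkoK.linForm`:

* `NesterenkoK.aeval_eq_zero_of_mem_elimIdeal` — a common zero `β̄ ∈ L^{m+1} ∖ 0` of `I` on the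
  hyperplanes `∑ⱼ u_{ij} xⱼ = 0` kills every `G ∈ Ī(r)` at `u` (any extension `L` of `F`);
* `NesterenkoK.exists_mem_elimIdeal_aeval_ne_zero` — conversely (`L` algebraically closed,
  `I` homogeneous), if NO non-zero `L`-zero of `I` lies on all the hyperplanes `uᵢ`, some
  `G ∈ Ī(r)` has `G(u) ≠ 0`;
* `NesterenkoK.aeval_generator_eq_zero_iff` — hence, when `Ī(r) = (F₀)` is principal, `F₀(u) = 0`
  iff the hyperplanes `uᵢ · x = 0` have a common zero on `V_L(I)`.

The proof is that of `NesterenkoEliminationZeros.lean` verbatim with `ℚ ↦ F`, `ℂ ↦ L` (main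
theorem of elimination theory for the family `(generators of I, L₁, …, L_r)` over the parameter
ring `F[U]`, through `Literature/NumberTheory/Automorphic/ProjectiveElimination.lean`: projective
Nullstellensatz `exists_ne_zero_common_zero_iff`, Sylvester map
`forall_monomial_mem_iff_surjective`, invertible maximal minor
`mulVec_surjective_iff_exists_det_ne_zero`, adjugate identity); the ring-generic lemmas of that
file (`forall_monomial_mem_succ`, `coeff_monomial_one_mul`, `eq_monomial_of_coeff`) are reused.

## References

* [NesterenkoPhilippon2001] Yu. V. Nesterenko, P. Philippon (eds.), *Introduction to Algebraic
  Independence Theory*, LNM 1752, Springer 2001, Ch. 3 §4, Def. 4.3, Prop. 4.4 (p. 38); Ch. 10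
  §2 (p. 153).
* I. R. Shafarevich, *Basic Algebraic Geometry 1*, I.5.2 (main theorem of elimination theory).
-/

noncomputable section

open MvPolynomial Literature.NumberTheory.Automorphic

namespace Literature.NumberTheory.Transcendental

namespace NesterenkoK

variable {F : Type*} [Field F] {L : Type*} [Field L] [Algebra F L] {m : ℕ}

/-! ### The easy direction: `Ī(r)` vanishes on hyperplanes through a zero of `I` -/

/-- If `β̄ ∈ L^{m+1} ∖ 0` is a zero of `I ⊂ F[x̲]` and `∑ⱼ u_{ij} βⱼ = 0` for all `i`, then
`G(u) = 0` for every `G ∈ Ī(r)`: substituting `x̲ = β̄`, `U = u` in `G xⱼ^M ∈ (I, L₁, …, L_r)`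
kills the right-hand side. [cite: NesterenkoPhilippon2001, Ch. 3 Def. 4.3 (p. 38)] -/
theorem aeval_eq_zero_of_mem_elimIdeal {r : ℕ} {I : Ideal (MvPolynomial (Fin (m + 1)) F)}
    {G : MvPolynomial (Fin r × Fin (m + 1)) F} (hG : G ∈ elimIdeal I r)
    {β : Fin (m + 1) → L} (hβ0 : β ≠ 0) (hβI : ∀ P ∈ I, aeval β P = 0)
    {u : Fin r × Fin (m + 1) → L} (hu : ∀ i : Fin r, ∑ j : Fin (m + 1), u (i, j) * β j = 0) :
    aeval u G = 0 := by
  obtain ⟨M, -, hM⟩ := hG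
  obtain ⟨j, hj⟩ := Function.ne_iff.mp hβ0
  set ev : MvPolynomial ((Fin r × Fin (m + 1)) ⊕ Fin (m + 1)) F →ₐ[F] L :=
    aeval (Sum.elim u β) with hev
  have ev_inl : ∀ G : MvPolynomial (Fin r × Fin (m + 1)) F, ev (rename Sum.inl G) = aeval u G :=
    fun G => by rw [hev, aeval_rename]; rfl
  have ev_inr : ∀ P : MvPolynomial (Fin (m + 1)) F, ev (rename Sum.inr P) = aeval β P :=
    fun P => by rw [hev, aeval_rename]; rfl
  have ev_L : ∀ i, ev (linForm F r m i) = 0 := fun i => by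
    simp only [hev, linForm, map_sum, map_mul, aeval_X, Sum.elim_inl, Sum.elim_inr]
    exact hu i
  have hker : extIdeal I r ≤ RingHom.ker ev := by
    refine sup_le ?_ ?_
    · rw [Ideal.map_le_iff_le_comap]
      intro P hP
      rw [Ideal.mem_comap, RingHom.mem_ker, ev_inr, hβI P hP]
    · rw [Ideal.span_le]
      rintro _ ⟨i, rfl⟩
      exact ev_L i
  have h := hker (hM j)
  rw [RingHom.mem_ker, map_mul, map_pow, ev_inl, hev, aeval_X, Sum.elim_inr] at h
  exact (mul_eq_zero.mp h).resolve_right (pow_ne_zero _ hj)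

/-! ### Homogeneous ideals have finite homogeneous generating families -/

/-- A homogeneous ideal of `F[x₀, …, x_m]` is generated by finitely many homogeneous polynomials
(the homogeneous components of a finite generating set). [folklore] -/
theorem exists_homogeneous_generators {I : Ideal (MvPolynomial (Fin (m + 1)) F)}
    (hI : letI := MvPolynomial.gradedAlgebra (σ := Fin (m + 1)) (R := F)
      I.IsHomogeneous (homogeneousSubmodule (Fin (m + 1)) F)) :
    ∃ (n : ℕ) (g : Fin n → MvPolynomial (Fin (m + 1)) F) (d : Fin n → ℕ),
      (∀ j, (g j).IsHomogeneous (d j)) ∧ Ideal.span (Set.range g) = I := by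
  classical
  obtain ⟨s, hs⟩ := (IsNoetherian.noetherian I : I.FG)
  -- the finite set of pairs (generator, degree)
  set T : Finset (MvPolynomial (Fin (m + 1)) F × ℕ) :=
    s.biUnion fun p => (Finset.range (p.totalDegree + 1)).image fun e => (p, e) with hT
  set n := T.card
  set e : Fin n ≃ T := (T.equivFin).symm
  refine ⟨n, fun j => homogeneousComponent (e j).1.2 (e j).1.1, fun j => (e j).1.2,
    fun j => homogeneousComponent_isHomogeneous _ _, le_antisymm ?_ ?_⟩
  · rw [Ideal.span_le]
    rintro _ ⟨j, rfl⟩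
    have hmem : (e j).1 ∈ s.biUnion fun p => (Finset.range (p.totalDegree + 1)).image
        fun e => (p, e) := (e j).2
    rw [Finset.mem_biUnion] at hmem
    obtain ⟨p, hp, hpe⟩ := hmem
    rw [Finset.mem_image] at hpe
    obtain ⟨k, -, hk⟩ := hpe
    have hpI : p ∈ I := by rw [← hs]; exact Ideal.subset_span hp
    show homogeneousComponent (e j).1.2 (e j).1.1 ∈ I
    have h1 : (e j).1.1 = p := by rw [← hk]
    have h2 : (e j).1.2 = k := by rw [← hk]
    rw [h1, h2]
    exact homogeneousComponent_mem_of_mem hI hpI k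
  · rw [← hs, Ideal.span_le]
    intro p hp
    rw [SetLike.mem_coe, ← sum_homogeneousComponent p]
    refine Ideal.sum_mem _ fun k hk => ?_
    have hpk : (p, k) ∈ T := by
      rw [hT, Finset.mem_biUnion]
      exact ⟨p, hp, Finset.mem_image.mpr ⟨k, hk, rfl⟩⟩
    have : homogeneousComponent k p = homogeneousComponent (e (e.symm ⟨(p, k), hpk⟩)).1.2
        (e (e.symm ⟨(p, k), hpk⟩)).1.1 := by
      rw [Equiv.apply_symm_apply]
    rw [this]
    exact Ideal.subset_span ⟨e.symm ⟨(p, k), hpk⟩, rfl⟩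

/-! ### The rings `F[U, x̲] ≃ F[U][x̲]` and the membership criterion for `Ī(r)` -/

section Family

variable {r : ℕ}

/-- The algebra isomorphism `F[U, x̲] ≃ F[U][x̲]` (`u_{ij} ↦ u_{ij}`, `xⱼ ↦ xⱼ`) exists
(Mathlib's `sumAlgEquiv` after swapping the two groups of variables). [folklore] -/
theorem exists_algEquiv_RUX (F : Type*) [Field F] (r m : ℕ) :
    ∃ τ : MvPolynomial ((Fin r × Fin (m + 1)) ⊕ Fin (m + 1)) F ≃ₐ[F]
        MvPolynomial (Fin (m + 1)) (MvPolynomial (Fin r × Fin (m + 1)) F),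
      (∀ v, τ (X (Sum.inl v)) = C (X v)) ∧ ∀ j, τ (X (Sum.inr j)) = X j :=
  ⟨(renameEquiv F (Equiv.sumComm (Fin r × Fin (m + 1)) (Fin (m + 1)))).trans
      (sumAlgEquiv F (Fin (m + 1)) (Fin r × Fin (m + 1))),
    fun v => by simp [sumAlgEquiv_X_inr], fun j => by simp [sumAlgEquiv_X_inl]⟩

variable {τ : MvPolynomial ((Fin r × Fin (m + 1)) ⊕ Fin (m + 1)) F ≃ₐ[F]
    MvPolynomial (Fin (m + 1)) (MvPolynomial (Fin r × Fin (m + 1)) F)}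

/-- Such an isomorphism sends `G ∈ F[U]` to the constant `G`. [folklore] -/
theorem algEquiv_rename_inl (hτl : ∀ v, τ (X (Sum.inl v)) = C (X v))
    (G : MvPolynomial (Fin r × Fin (m + 1)) F) :
    τ (rename Sum.inl G) = C G := by
  induction G using MvPolynomial.induction_on with
  | C a =>
    rw [rename_C, show (C a : MvPolynomial ((Fin r × Fin (m + 1)) ⊕ Fin (m + 1)) F) =
      algebraMap F _ a from rfl, AlgEquiv.commutes]
    simp [MvPolynomial.algebraMap_apply, MvPolynomial.algebraMap_eq]
  | add p q hp hq => rw [map_add, map_add, hp, hq, map_add]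
  | mul_X p v hp => rw [map_mul, map_mul, hp, rename_X, hτl, map_mul]

/-- … and `P ∈ F[x̲]` to `P` with constant coefficients. [folklore] -/
theorem algEquiv_rename_inr (hτr : ∀ j, τ (X (Sum.inr j)) = X j)
    (P : MvPolynomial (Fin (m + 1)) F) :
    τ (rename Sum.inr P) = map (algebraMap F (MvPolynomial (Fin r × Fin (m + 1)) F)) P := by
  induction P using MvPolynomial.induction_on with
  | C a =>
    rw [rename_C, show (C a : MvPolynomial ((Fin r × Fin (m + 1)) ⊕ Fin (m + 1)) F) =
      algebraMap F _ a from rfl, AlgEquiv.commutes, map_C]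
    simp [MvPolynomial.algebraMap_apply, MvPolynomial.algebraMap_eq]
  | add p q hp hq => rw [map_add, map_add, hp, hq, map_add]
  | mul_X p v hp => rw [map_mul, map_mul, hp, rename_X, hτr, map_mul, map_X]

/-- … and `Lᵢ` to the linear form `∑ⱼ u_{ij} xⱼ` with coefficients `u_{ij} ∈ F[U]`. [folklore] -/
theorem algEquiv_linForm (hτl : ∀ v, τ (X (Sum.inl v)) = C (X v))
    (hτr : ∀ j, τ (X (Sum.inr j)) = X j) (i : Fin r) :
    τ (linForm F r m i) = ∑ j : Fin (m + 1), C (X (i, j)) * X j := by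
  simp only [linForm, map_sum, map_mul, hτl, hτr]

/-- **Membership criterion for `Ī(r)` read in `F[U][x̲]`**: if a family `f` consists of images
of elements of `(I, L₁, …, L_r)` and `G xⱼ^D ∈ (f)` for all `j` (`D > 0`), then `G ∈ Ī(r)`.
[cite: NesterenkoPhilippon2001, Ch. 3 Def. 4.3 (p. 38)] -/
theorem mem_elimIdeal_of_forall_C_mul_X_pow_mem (hτl : ∀ v, τ (X (Sum.inl v)) = C (X v))
    (hτr : ∀ j, τ (X (Sum.inr j)) = X j) {I : Ideal (MvPolynomial (Fin (m + 1)) F)} {k : ℕ}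
    {f : Fin k → MvPolynomial (Fin (m + 1)) (MvPolynomial (Fin r × Fin (m + 1)) F)}
    (hf : ∀ c, ∃ y ∈ extIdeal I r, τ y = f c)
    {G : MvPolynomial (Fin r × Fin (m + 1)) F} {D : ℕ} (hD : 0 < D)
    (h : ∀ j : Fin (m + 1), C G * X j ^ D ∈ Ideal.span (Set.range f)) :
    G ∈ elimIdeal I r := by
  have hle : Ideal.span (Set.range f) ≤ Ideal.map τ (extIdeal I r) := by
    rw [Ideal.span_le]
    rintro _ ⟨c, rfl⟩
    obtain ⟨y, hy, hyc⟩ := hf c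
    rw [SetLike.mem_coe, ← hyc]
    exact Ideal.mem_map_of_mem _ hy
  refine ⟨D, hD, fun j => ?_⟩
  have h1 := hle (h j)
  have e : C G * X j ^ D = τ (rename Sum.inl G * X (Sum.inr j) ^ D) := by
    rw [map_mul, map_pow, algEquiv_rename_inl hτl, hτr]
  rw [e] at h1
  exact (Ideal.apply_mem_of_equiv_iff (f := τ.toRingEquiv)).mp h1

omit [Algebra F L] in
/-- The Sylvester matrix of a specialised family `ψ(f)` (`ψ : F[U] → L`) is the specialisation
of the Sylvester matrix with entries in `F[U]`. [folklore] -/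
theorem sylvesterMatrix_map_family {k : ℕ}
    (f : Fin k → MvPolynomial (Fin (m + 1)) (MvPolynomial (Fin r × Fin (m + 1)) F))
    (d : Fin k → ℕ) (D : ℕ) (ψ : MvPolynomial (Fin r × Fin (m + 1)) F →+* L) :
    sylvesterMatrix (fun c => map ψ (f c)) d D = (sylvesterMatrixPoly f d D).map ψ := by
  ext s c
  rw [sylvesterMatrix_apply, Matrix.map_apply, sylvesterMatrixPoly]
  split_ifs with h
  · rw [coeff_map]
  · rw [map_zero]

/-- **The adjugate step.** Let `S` be a square submatrix (all rows, columns `J`) of the Sylvester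
matrix of a homogeneous family `f` over `F[U]`, `G = det S`. Then `G · x^{s₀} ∈ (f)` for every
monomial `x^{s₀}` of degree `D`. [folklore] -/
theorem C_det_mul_monomial_mem_span {k' : ℕ}
    {f : Fin k' → MvPolynomial (Fin (m + 1)) (MvPolynomial (Fin r × Fin (m + 1)) F)}
    {d : Fin k' → ℕ} (hf : ∀ c, (f c).IsHomogeneous (d c)) (D : ℕ)
    (J : Exps (Fin (m + 1)) D → SylCols (Fin (m + 1)) d D) (s₀ : Exps (Fin (m + 1)) D) :
    C ((sylvesterMatrixPoly f d D).submatrix id J).det *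
        monomial s₀.1 (1 : MvPolynomial (Fin r × Fin (m + 1)) F) ∈
      Ideal.span (Set.range f) := by
  classical
  set M := sylvesterMatrixPoly f d D with hMdef
  set S := M.submatrix id J with hS
  set adj := S.adjugate with hadj
  -- the combination `P = ∑_{s'} adj_{s' s₀} · x^{t(J s')} f_{j(J s')}`
  set P : MvPolynomial (Fin (m + 1)) (MvPolynomial (Fin r × Fin (m + 1)) F) :=
    ∑ s' : Exps (Fin (m + 1)) D, C (adj s' s₀) *
      (monomial (J s').2.1 (1 : MvPolynomial (Fin r × Fin (m + 1)) F) * f (J s').1.1)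
    with hP
  have hPmem : P ∈ Ideal.span (Set.range f) := by
    refine Ideal.sum_mem _ fun s' _ => ?_
    rw [← mul_assoc]
    exact Ideal.mul_mem_left _ _ (Ideal.subset_span ⟨(J s').1.1, rfl⟩)
  have hPhom : P.IsHomogeneous D := by
    refine IsHomogeneous.sum _ _ _ fun s' _ => ?_
    have h1 : (monomial (J s').2.1 (1 : MvPolynomial (Fin r × Fin (m + 1)) F) *
        f (J s').1.1).IsHomogeneous (D - d (J s').1.1 + d (J s').1.1) :=
      (isHomogeneous_monomial _ (J s').2.2).mul (hf (J s').1.1)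
    rw [Nat.sub_add_cancel (J s').1.2] at h1
    exact h1.C_mul _
  -- its coefficients are `det S · δ_{s s₀}`
  have hcoeff : ∀ s : Fin (m + 1) →₀ ℕ, ∀ hs : s.degree = D,
      coeff s P = if (⟨s, hs⟩ : Exps (Fin (m + 1)) D) = s₀ then S.det else 0 := by
    intro s hs
    have e1 : coeff s P = ∑ s' : Exps (Fin (m + 1)) D, S ⟨s, hs⟩ s' * adj s' s₀ := by
      rw [hP, coeff_sum]
      refine Finset.sum_congr rfl fun s' _ => ?_
      rw [coeff_C_mul, Nesterenko.coeff_monomial_one_mul, mul_comm]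
      rfl
    rw [e1, ← Matrix.mul_apply, hadj, Matrix.mul_adjugate, Matrix.smul_apply, Matrix.one_apply,
      smul_eq_mul, mul_ite, mul_one, mul_zero]
  have hPeq : P = monomial s₀.1 S.det := by
    refine Nesterenko.eq_monomial_of_coeff hPhom s₀.2 ?_ fun s hs hss => ?_
    · rw [hcoeff s₀.1 s₀.2, if_pos rfl]
    · rw [hcoeff s hs, if_neg (fun h' => hss (congrArg Subtype.val h'))]
  have e2 : C S.det * monomial s₀.1 (1 : MvPolynomial (Fin r × Fin (m + 1)) F) =
      monomial s₀.1 S.det := by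
    rw [C_mul_monomial, mul_one]
  rw [e2, ← hPeq]
  exact hPmem

end Family

/-! ### The hard direction -/

/-- **Zeros of `Ī(r)`, hard direction, over any base field.** Let `I ⊂ F[x₀, …, x_m]` be a
homogeneous ideal, `L ⊇ F` algebraically closed and `u = (u₁, …, u_r) ∈ L^{r(m+1)}`. If no
non-zero `L`-zero of `I` lies on all the hyperplanes `∑ⱼ u_{ij} xⱼ = 0`, then some `G ∈ Ī(r)`
does not vanish at `u`. (Main theorem of elimination theory for the family `(I, L₁, …, L_r)`
over `F[U]`, via the Sylvester matrix.)
[cite: NesterenkoPhilippon2001, Ch. 3 Def. 4.3, Prop. 4.4 (p. 38)] -/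
theorem exists_mem_elimIdeal_aeval_ne_zero [IsAlgClosed L] {r : ℕ}
    {I : Ideal (MvPolynomial (Fin (m + 1)) F)}
    (hI : letI := MvPolynomial.gradedAlgebra (σ := Fin (m + 1)) (R := F)
      I.IsHomogeneous (homogeneousSubmodule (Fin (m + 1)) F))
    (u : Fin r × Fin (m + 1) → L)
    (hu : ∀ β : Fin (m + 1) → L, β ≠ 0 → (∀ P ∈ I, aeval β P = 0) →
      ∃ i : Fin r, ∑ j : Fin (m + 1), u (i, j) * β j ≠ 0) :
    ∃ G ∈ elimIdeal I r, aeval u G ≠ 0 := by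
  classical
  obtain ⟨n, g, d, hg, hspan⟩ := exists_homogeneous_generators hI
  have hgI : ∀ j, g j ∈ I := fun j => by rw [← hspan]; exact Ideal.subset_span ⟨j, rfl⟩
  obtain ⟨τ, hτl, hτr⟩ := exists_algEquiv_RUX F r m
  -- the family `(g₁, …, g_n, L₁, …, L_r)` in `F[U][x̲]` and its degrees
  set f : Fin (n + r) → MvPolynomial (Fin (m + 1)) (MvPolynomial (Fin r × Fin (m + 1)) F) :=
    Fin.append (fun j => map (algebraMap F (MvPolynomial (Fin r × Fin (m + 1)) F)) (g j))
      (fun i => ∑ j : Fin (m + 1), C (X (i, j)) * X j) with hfdef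
  set df : Fin (n + r) → ℕ := Fin.append d (fun _ => 1) with hdfdef
  have hf_left : ∀ j, f (Fin.castAdd r j) =
      map (algebraMap F (MvPolynomial (Fin r × Fin (m + 1)) F)) (g j) := fun j => by
    simp [hfdef]
  have hf_right : ∀ i, f (Fin.natAdd n i) = ∑ j : Fin (m + 1), C (X (i, j)) * X j := fun i => by
    simp [hfdef]
  have hdf_left : ∀ j, df (Fin.castAdd r j) = d j := fun j => by simp [hdfdef]
  have hdf_right : ∀ i, df (Fin.natAdd n i) = 1 := fun i => by simp [hdfdef]
  have hfhom : ∀ c, (f c).IsHomogeneous (df c) := by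
    refine Fin.addCases (fun j => ?_) (fun i => ?_)
    · rw [hf_left, hdf_left]
      exact (hg j).map _
    · rw [hf_right, hdf_right]
      exact IsHomogeneous.sum _ _ _ fun j _ => (isHomogeneous_X _ j).C_mul _
  have hfext : ∀ c, ∃ y ∈ extIdeal I r, τ y = f c := by
    refine Fin.addCases (fun j => ?_) (fun i => ?_)
    · exact ⟨rename Sum.inr (g j), Ideal.mem_sup_left (Ideal.mem_map_of_mem _ (hgI j)),
        by rw [algEquiv_rename_inr hτr, hf_left]⟩
    · exact ⟨linForm F r m i, Ideal.mem_sup_right (Ideal.subset_span ⟨i, rfl⟩),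
        by rw [algEquiv_linForm hτl hτr, hf_right]⟩
  -- the specialised family `(g₁, …, g_n, u₁ · x, …, u_r · x) ⊂ L[x̲]`
  set ψ : MvPolynomial (Fin r × Fin (m + 1)) F →+* L :=
    (aeval u : MvPolynomial (Fin r × Fin (m + 1)) F →ₐ[F] L).toRingHom with hψ
  have hψ_apply : ∀ G : MvPolynomial (Fin r × Fin (m + 1)) F, ψ G = aeval u G := fun G => rfl
  set fs : Fin (n + r) → MvPolynomial (Fin (m + 1)) L := fun c => map ψ (f c) with hfs
  have hfs_left : ∀ j, fs (Fin.castAdd r j) = map (algebraMap F L) (g j) := fun j => by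
    have h : ψ.comp (algebraMap F (MvPolynomial (Fin r × Fin (m + 1)) F)) = algebraMap F L := by
      rw [hψ]
      exact (aeval u : MvPolynomial (Fin r × Fin (m + 1)) F →ₐ[F] L).comp_algebraMap
    show map ψ (f (Fin.castAdd r j)) = _
    rw [hf_left, map_map, h]
  have hfs_right : ∀ i, fs (Fin.natAdd n i) = ∑ j : Fin (m + 1), C (u (i, j)) * X j := fun i => by
    show map ψ (f (Fin.natAdd n i)) = _
    rw [hf_right, map_sum]
    refine Finset.sum_congr rfl fun j _ => ?_
    rw [map_mul, map_C, map_X, hψ_apply, aeval_X]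
  have hfshom : ∀ c, (fs c).IsHomogeneous (df c) := fun c => (hfhom c).map _
  -- it has no common zero `x ≠ 0`
  have hno : ¬ ∃ x : Fin (m + 1) → L, x ≠ 0 ∧ ∀ c, eval x (fs c) = 0 := by
    rintro ⟨x, hx0, hx⟩
    have hxV : ∀ P ∈ I, aeval x P = 0 := by
      intro P hP
      rw [← hspan] at hP
      have hgen : ∀ j, aeval x (g j) = 0 := fun j => by
        have := hx (Fin.castAdd r j)
        rwa [hfs_left, eval_map, ← aeval_def] at this
      rw [← RingHom.mem_ker]
      refine (Ideal.span_le.mpr ?_) hP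
      rintro _ ⟨j, rfl⟩
      exact (RingHom.mem_ker).mpr (hgen j)
    obtain ⟨i, hi⟩ := hu x hx0 hxV
    have := hx (Fin.natAdd n i)
    rw [hfs_right, map_sum] at this
    exact hi (by simpa [eval_C, eval_X] using this)
  rw [exists_ne_zero_common_zero_iff] at hno
  push Not at hno
  obtain ⟨D₀, hD₀⟩ := hno
  -- all monomials of degree `D = D₀ + 1 ≥ 1` lie in the specialised ideal: a maximal minor
  set D := D₀ + 1 with hDdef
  have hD : ∀ s : Fin (m + 1) →₀ ℕ, s.degree = D →
      monomial s (1 : L) ∈ Ideal.span (Set.range fs) :=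
    Nesterenko.forall_monomial_mem_succ hD₀
  rw [forall_monomial_mem_iff_surjective hfshom D, mulVec_surjective_iff_exists_det_ne_zero] at hD
  obtain ⟨J, hJ⟩ := hD
  rw [hfs, sylvesterMatrix_map_family f df D ψ, Matrix.submatrix_map, ← RingHom.mapMatrix_apply,
    ← RingHom.map_det] at hJ
  refine ⟨((sylvesterMatrixPoly f df D).submatrix id J).det, ?_, hJ⟩
  refine mem_elimIdeal_of_forall_C_mul_X_pow_mem hτl hτr hfext (Nat.succ_pos D₀) fun j => ?_
  have hdeg : (Finsupp.single j D : Fin (m + 1) →₀ ℕ).degree = D := by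
    simp [Finsupp.degree_single]
  have := C_det_mul_monomial_mem_span hfhom D J ⟨Finsupp.single j D, hdeg⟩
  rwa [X_pow_eq_monomial]

/-- **Zeros of a generator of `Ī(r)` (the associated form).** If `Ī(r) = (F₀)` is principal, then
for `u ∈ L^{r(m+1)}` (`L ⊇ F` algebraically closed, `I` homogeneous): `F₀(u) = 0` iff some
non-zero `L`-zero `β̄` of `I` lies on all the hyperplanes `uᵢ · x = 0`.
[cite: NesterenkoPhilippon2001, Ch. 3 Prop. 4.4 and the paragraph after it (p. 38)] -/
theorem aeval_generator_eq_zero_iff [IsAlgClosed L] {r : ℕ}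
    {I : Ideal (MvPolynomial (Fin (m + 1)) F)}
    (hI : letI := MvPolynomial.gradedAlgebra (σ := Fin (m + 1)) (R := F)
      I.IsHomogeneous (homogeneousSubmodule (Fin (m + 1)) F))
    {F₀ : MvPolynomial (Fin r × Fin (m + 1)) F} (hF₀ : Ideal.span {F₀} = elimIdeal I r)
    (u : Fin r × Fin (m + 1) → L) :
    aeval u F₀ = 0 ↔
      ∃ β : Fin (m + 1) → L, β ≠ 0 ∧ (∀ P ∈ I, aeval β P = 0) ∧
        ∀ i : Fin r, ∑ j : Fin (m + 1), u (i, j) * β j = 0 := by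
  constructor
  · intro h
    by_contra hne
    push Not at hne
    obtain ⟨G, hG, hGu⟩ := exists_mem_elimIdeal_aeval_ne_zero hI u
      fun β hβ0 hβI => hne β hβ0 hβI
    rw [← hF₀, Ideal.mem_span_singleton] at hG
    obtain ⟨H, rfl⟩ := hG
    rw [map_mul, h, zero_mul] at hGu
    exact hGu rfl
  · rintro ⟨β, hβ0, hβI, hL⟩
    have hF : F₀ ∈ elimIdeal I r := by
      rw [← hF₀]
      exact Ideal.mem_span_singleton_self _
    exact aeval_eq_zero_of_mem_elimIdeal hF hβ0 hβI hL

/-- In particular, if `Ī(r) = (F₀)` and `I` has a non-zero zero in an algebraically closed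
`L ⊇ F`, then `F₀` vanishes at `u = 0`. [folklore] -/
theorem aeval_zero_generator [IsAlgClosed L] {r : ℕ}
    {I : Ideal (MvPolynomial (Fin (m + 1)) F)}
    (hI : letI := MvPolynomial.gradedAlgebra (σ := Fin (m + 1)) (R := F)
      I.IsHomogeneous (homogeneousSubmodule (Fin (m + 1)) F))
    {F₀ : MvPolynomial (Fin r × Fin (m + 1)) F} (hF₀ : Ideal.span {F₀} = elimIdeal I r)
    (hne : ∃ β : Fin (m + 1) → L, β ≠ 0 ∧ ∀ P ∈ I, aeval β P = 0) :
    aeval (0 : Fin r × Fin (m + 1) → L) F₀ = 0 := by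
  obtain ⟨β, hβ0, hβI⟩ := hne
  exact (aeval_generator_eq_zero_iff hI hF₀ 0).mpr ⟨β, hβ0, hβI, fun i => by simp⟩

end NesterenkoK

end Literature.NumberTheory.Transcendental

end
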